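import Literature.MathematicalPhysics.QuantumFieldTheory.TorusChartAxialSums
import Literature.MathematicalPhysics.QuantumFieldTheory.TorusChartCombGauge
import Literature.MathematicalPhysics.QuantumFieldTheory.TorusChartVorticity
import HarnessLib

/-!
# The degree-two Poincaré lemma on a charted torus: which plaquette fields are curls

On a charted torus `F : TorusChart Λ d` (`TorusChart.lean`) with coefficients in an arbitrary abelian group
`A`, a `2`-cochain `q : Λ → Fin d → Fin d → A` is the curl `d₁ θ` of some `1`-cochain iff it is

* alternating (`TorusChart.IsAlt₂`: `q x i i = 0`, `q x j i = - q x i j`),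
* closed (`F.d₂ q = 0`, `TorusChartVorticity.lean`), and
* has vanishing **fluxes** through the `d(d-1)/2` coordinate `2`-tori through the origin
  (`TorusChart.flux F q i j = Σ_{m < N_j} Σ_{n < N_i} q (m • e_j + n • e_i; i, j)`)

— `TorusChart.exists_d₁_eq_iff`, equivalently `TorusChart.mem_curlImage_iff_closed` for the subgroup
`curlImage` of `TorusChartCombGauge.lean`.  Together with the labelling `sectorEquiv` of that file this makes
the vortex sectors of the Villain / Fröhlich–Spencer unfolding explicit: pairs (closed zero-flux vortex current,
winding vector).  (Over `ℤ` this is `H²(T^d; ℤ) ≅ ℤ^{d(d-1)/2}` detected by the fluxes; the statement holds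
for every coefficient group because the cellular cochain complex of the torus has free homology.)

## Proof

Necessity is Stokes (`flux_d₁`: circle sums of differences telescope).  Sufficiency is a sweep, one direction
at a time (`exists_d₁_eq_of_vanish`): if `q` vanishes on all index pairs involving a direction `< k`, the
cochain `sweep κ q` (`κ = k`) — partial sums of the row `q(·; κ, j)` along direction `κ` from the slice
`{x_κ = 0}` (`TorusChartAxialSums.lean`), corrected on the last layer `{x_κ = N_κ - 1}` by a `0`-cochain `g`
with `d₀ g (x, j) = -(circle sum of q(·; κ, j))` — has curl `q` on the pairs `(κ, j)` (`d₁_sweep_row`) and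
zero curl on the pairs below `κ` (`d₁_sweep_below`), so `q - d₁ (sweep κ q)` vanishes on all pairs involving
a direction `< k + 1`.  The corrector `g` exists by the degree-ONE structure theorem
(`TorusChartFlatCochains.exists_d₀_eq_iff`): the cochain of circle sums `rowCirc κ q` is flat because `q` is
closed (`isFlat_rowCirc`) and has winding vector `-(fluxes of q) = 0` (`wind_rowCirc`).

Everything is proved; no named fact is introduced.

## References

* B. Eckmann, Comment. Math. Helv. 17 (1945) 240–255 (cohomology of finite cell complexes). [folklore form]
* J. Fröhlich, T. Spencer, Comm. Math. Phys. 81 (1981) 527–602, §3 (vortex currents as closed `2`-forms).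
  [folklore form]
-/

namespace Literature.MathematicalPhysics.QuantumFieldTheory

open scoped BigOperators

namespace TorusChart

variable {Λ : Type*} [AddCommGroup Λ] {d : ℕ} (F : TorusChart Λ d)
variable {A : Type*} [AddCommGroup A]

/-! ## Alternating `2`-cochains -/

/-- A `2`-cochain is **alternating**: zero diagonal and antisymmetric (both conditions are needed over a
general coefficient group). [folklore] -/
structure IsAlt₂ (q : Λ → Fin d → Fin d → A) : Prop where
  /-- the diagonal vanishes -/
  diag : ∀ (x : Λ) (i : Fin d), q x i i = 0
  /-- antisymmetry -/
  swap : ∀ (x : Λ) (i j : Fin d), q x j i = -q x i j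

/-- Curls are alternating. [folklore] -/
theorem isAlt₂_d₁ (θ : Λ → Fin d → A) : IsAlt₂ (F.d₁ θ) :=
  ⟨F.d₁_self θ, F.d₁_swap θ⟩

omit [AddCommGroup Λ] in
/-- The zero `2`-cochain is alternating. [folklore] -/
theorem isAlt₂_zero : IsAlt₂ (0 : Λ → Fin d → Fin d → A) :=
  ⟨fun _ _ => rfl, fun _ _ _ => by simp⟩

omit [AddCommGroup Λ] in
/-- Alternating cochains are closed under subtraction. [folklore] -/
theorem IsAlt₂.sub {q p : Λ → Fin d → Fin d → A} (hq : IsAlt₂ q) (hp : IsAlt₂ p) : IsAlt₂ (q - p) :=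
  ⟨fun x i => by simp only [Pi.sub_apply, hq.diag, hp.diag, sub_zero],
    fun x i j => by
      simp only [Pi.sub_apply]
      rw [hq.swap, hp.swap, neg_sub_neg, neg_sub]⟩

/-- `d₂` is subtractive. [folklore] -/
theorem d₂_sub (ω ω' : Λ → Fin d → Fin d → A) : F.d₂ (ω - ω') = F.d₂ ω - F.d₂ ω' := by
  funext x i j k; simp only [d₂_apply, Pi.sub_apply]; abel

/-! ## Fluxes through the coordinate `2`-tori -/

/-- The **flux** of a `2`-cochain through the coordinate `2`-torus in directions `(i, j)` through the origin:
`Σ_{m < N_j} Σ_{n < N_i} q (m • e_j + n • e_i; i, j)` (written with circle sums in direction `i`). [folklore] -/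
def flux (q : Λ → Fin d → Fin d → A) (i j : Fin d) : A :=
  ∑ m ∈ Finset.range (F.period j), F.circSum i (fun y => q y i j) (m • F.gen j)

/-- Unfolding `flux`. [folklore] -/
theorem flux_def (q : Λ → Fin d → Fin d → A) (i j : Fin d) :
    F.flux q i j = ∑ m ∈ Finset.range (F.period j), F.circSum i (fun y => q y i j) (m • F.gen j) := rfl

/-- `flux` is subtractive. [folklore] -/
theorem flux_sub (q p : Λ → Fin d → Fin d → A) (i j : Fin d) : F.flux (q - p) i j = F.flux q i j - F.flux p i j := by
  simp only [flux, Pi.sub_apply, circSum_sub, Finset.sum_sub_distrib]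

/-- **Stokes: curls have no flux.** [folklore] -/
theorem flux_d₁ (θ : Λ → Fin d → A) (i j : Fin d) : F.flux (F.d₁ θ) i j = 0 := by
  -- the `i`-differences die around the `i`-circle; what is left are `j`-differences of circle sums
  have hsplit : ∀ m : ℕ, F.circSum i (fun y => F.d₁ θ y i j) (m • F.gen j) =
      -F.circSum i (fun y => θ (y + F.gen j) i - θ y i) (m • F.gen j) := fun m => by
    have h1 : (fun y => F.d₁ θ y i j) =
        fun y => (θ (y + F.gen i) j - θ y j) - (θ (y + F.gen j) i - θ y i) := by
      funext y; simp only [d₁_apply]; abel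
    rw [h1, circSum_sub, F.circSum_sub_add_gen_self i (fun y => θ y j), zero_sub]
  simp only [flux, hsplit, Finset.sum_neg_distrib, neg_eq_zero]
  by_cases hij : j = i
  · subst hij
    exact Finset.sum_eq_zero fun m _ => F.circSum_sub_add_gen_self j (fun y => θ y j) _
  · -- the `j`-differences telescope in `m` around the `j`-circle
    have hshift : ∀ m : ℕ, F.circSum i (fun y => θ (y + F.gen j) i) (m • F.gen j) =
        F.circSum i (fun y => θ y i) ((m + 1) • F.gen j) := fun m => by
      rw [succ_nsmul, F.circSum_add_gen_of_ne hij]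
    simp only [circSum_sub, hshift]
    rw [Finset.sum_range_sub (fun m => F.circSum i (fun y => θ y i) (m • F.gen j)), F.period_nsmul_gen,
      zero_nsmul, sub_self]

/-! ## The row circle sums: a flat, windless `1`-cochain -/

/-- The **row circle sums** of `q` in direction `κ`: `rowCirc κ q (x, j) = -Σ_{circle} q(·; κ, j)` for `j ≠ κ`
and `0` for `j = κ`; this is the gradient the seam corrector must have. [folklore] -/
def rowCirc (κ : Fin d) (q : Λ → Fin d → Fin d → A) : Λ → Fin d → A :=
  fun x j => if j = κ then 0 else -F.circSum κ (fun y => q y κ j) x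

/-- `rowCirc` in direction `κ` vanishes. [folklore] -/
theorem rowCirc_self (κ : Fin d) (q : Λ → Fin d → Fin d → A) (x : Λ) : F.rowCirc κ q x κ = 0 := by
  rw [rowCirc, if_pos rfl]

/-- `rowCirc` in a direction `j ≠ κ`. [folklore] -/
theorem rowCirc_of_ne (κ : Fin d) (q : Λ → Fin d → Fin d → A) (x : Λ) {j : Fin d} (hj : j ≠ κ) :
    F.rowCirc κ q x j = -F.circSum κ (fun y => q y κ j) x := by
  rw [rowCirc, if_neg hj]

/-- `rowCirc` is invariant under steps in direction `κ`. [folklore] -/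
theorem rowCirc_add_gen_self (κ : Fin d) (q : Λ → Fin d → Fin d → A) (x : Λ) (j : Fin d) :
    F.rowCirc κ q (x + F.gen κ) j = F.rowCirc κ q x j := by
  by_cases hj : j = κ
  · rw [hj, rowCirc_self, rowCirc_self]
  · rw [F.rowCirc_of_ne κ q _ hj, F.rowCirc_of_ne κ q _ hj, circSum_add_gen_self]

variable {F} in
/-- **The row circle sums of a closed `2`-cochain form a flat `1`-cochain** (closedness on the cells
`(κ, i, j)` summed around the `κ`-circle). [folklore] -/
theorem isFlat_rowCirc (κ : Fin d) {q : Λ → Fin d → Fin d → A} (hq : F.d₂ q = 0) : F.IsFlat (F.rowCirc κ q) := by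
  intro x i j
  rw [d₁_apply]
  by_cases hi : i = κ
  · subst hi
    rw [rowCirc_self, rowCirc_self, rowCirc_add_gen_self]; abel
  by_cases hj : j = κ
  · subst hj
    rw [rowCirc_self, rowCirc_self, rowCirc_add_gen_self]; abel
  rw [F.rowCirc_of_ne κ q x hi, F.rowCirc_of_ne κ q (x + F.gen i) hj, F.rowCirc_of_ne κ q (x + F.gen j) hi,
    F.rowCirc_of_ne κ q x hj, F.circSum_add_gen_of_ne hi, F.circSum_add_gen_of_ne hj]
  -- closedness on the cell `(y; κ, i, j)`: `∂_i q_{κj} - ∂_j q_{κi} = ∂_κ q_{ij}`, whose circle sum telescopes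
  have hcell : ∀ y : Λ, (q (y + F.gen i) κ j - q y κ j) - (q (y + F.gen j) κ i - q y κ i) =
      q (y + F.gen κ) i j - q y i j := fun y => by
    have h := congr_fun (congr_fun (congr_fun (congr_fun hq y) κ) i) j
    simp only [d₂_apply, Pi.zero_apply] at h
    -- h : (q (y+e_κ) i j - q y i j) - (q (y+e_i) κ j - q y κ j) + (q (y+e_j) κ i - q y κ i) = 0
    rw [← sub_eq_zero, ← neg_eq_zero, ← h]
    abel
  have hsum : F.circSum κ (fun y => q (y + F.gen i) κ j) x - F.circSum κ (fun y => q y κ j) x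
      - (F.circSum κ (fun y => q (y + F.gen j) κ i) x - F.circSum κ (fun y => q y κ i) x) = 0 := by
    rw [← circSum_sub, ← circSum_sub, ← circSum_sub]
    have : (fun y => (q (y + F.gen i) κ j - q y κ j) - (q (y + F.gen j) κ i - q y κ i)) =
        fun y => q (y + F.gen κ) i j - q y i j := funext hcell
    rw [this]
    exact F.circSum_sub_add_gen_self κ (fun y => q y i j) x
  rw [← neg_eq_zero]
  rw [← hsum]
  abel

/-- **The winding vector of the row circle sums is minus the flux vector**:
`wind (rowCirc κ q) μ = -flux q κ μ` for `μ ≠ κ` (and `0` for `μ = κ`). [folklore] -/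
theorem wind_rowCirc (κ : Fin d) (q : Λ → Fin d → Fin d → A) (μ : Fin d) :
    F.wind (F.rowCirc κ q) μ = if μ = κ then 0 else -F.flux q κ μ := by
  rw [wind_eq, lineSum]
  simp only [zero_add]
  split_ifs with hμ
  · exact Finset.sum_eq_zero fun m _ => by rw [hμ]; exact F.rowCirc_self κ q _
  · rw [flux, ← Finset.sum_neg_distrib]
    exact Finset.sum_congr rfl fun m _ => F.rowCirc_of_ne κ q _ hμ

variable {F} in
/-- **The seam corrector exists**: for a closed `q` with vanishing fluxes out of direction `κ`, the row circle
sums are the gradient of their axial primitive. [folklore] -/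
theorem rowCirc_eq_d₀_prim (κ : Fin d) {q : Λ → Fin d → Fin d → A} (hq : F.d₂ q = 0)
    (hflux : ∀ j, F.flux q κ j = 0) : F.rowCirc κ q = F.d₀ (F.prim (F.rowCirc κ q)) := by
  refine eq_d₀_prim_of_wind_eq_zero (isFlat_rowCirc κ hq) ?_
  funext μ
  rw [wind_rowCirc, Pi.zero_apply]
  split_ifs with hμ
  · rfl
  · rw [hflux μ, neg_zero]

/-! ## The sweep cochain -/

/-- The **sweep cochain** in direction `κ`: for `j ≠ κ` the partial sums of the row `q(·; κ, j)` along the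
`κ`-line from the slice `{x_κ = 0}`; in direction `κ` the seam corrector `prim (rowCirc κ q)` on the last layer
`{x_κ = N_κ - 1}` and `0` elsewhere. [folklore] -/
noncomputable def sweep (κ : Fin d) (q : Λ → Fin d → Fin d → A) : Λ → Fin d → A := fun x j =>
  if j = κ then (if F.cval κ x + 1 = F.period κ then F.prim (F.rowCirc κ q) x else 0)
  else F.axSum κ (fun y => q y κ j) x

/-- The sweep cochain in a direction `j ≠ κ`. [folklore] -/
theorem sweep_of_ne (κ : Fin d) (q : Λ → Fin d → Fin d → A) (x : Λ) {j : Fin d} (hj : j ≠ κ) :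
    F.sweep κ q x j = F.axSum κ (fun y => q y κ j) x := by
  rw [sweep, if_neg hj]

/-- The sweep cochain in direction `κ`. [folklore] -/
theorem sweep_self (κ : Fin d) (q : Λ → Fin d → Fin d → A) (x : Λ) :
    F.sweep κ q x κ = if F.cval κ x + 1 = F.period κ then F.prim (F.rowCirc κ q) x else 0 := by
  rw [sweep, if_pos rfl]

/-- The `κ`-component of the sweep cochain is invariant under transverse steps up to the corrector's gradient:
`sweep (x + e_i) κ - sweep x κ = [x on the last layer] · rowCirc κ q (x, i)` for `i ≠ κ` (given that the
corrector integrates `rowCirc`). [folklore] -/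
theorem sweep_self_add_gen_sub (κ : Fin d) {q : Λ → Fin d → Fin d → A}
    (hcorr : F.rowCirc κ q = F.d₀ (F.prim (F.rowCirc κ q))) (x : Λ) {i : Fin d} (hi : i ≠ κ) :
    F.sweep κ q (x + F.gen i) κ - F.sweep κ q x κ =
      if F.cval κ x + 1 = F.period κ then F.rowCirc κ q x i else 0 := by
  rw [sweep_self, sweep_self, F.cval_add_gen_of_ne x (Ne.symm hi)]
  split_ifs with hx
  · have h := congr_fun (congr_fun hcorr x) i
    rw [d₀_apply] at h
    exact h.symm
  · exact sub_zero _

variable {F} in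
/-- **The sweep produces the row**: `d₁ (sweep κ q) (x; κ, j) = q (x; κ, j)` for `j ≠ κ`, provided `q` is
closed with vanishing fluxes out of direction `κ`. [folklore] -/
theorem d₁_sweep_row (κ : Fin d) {q : Λ → Fin d → Fin d → A} (hq : F.d₂ q = 0)
    (hflux : ∀ j, F.flux q κ j = 0) (x : Λ) {j : Fin d} (hj : j ≠ κ) :
    F.d₁ (F.sweep κ q) x κ j = q x κ j := by
  have hcorr := rowCirc_eq_d₀_prim κ hq hflux
  -- `d₁ θ x κ j = θ x κ + θ (x + e_κ) j - θ (x + e_j) κ - θ x j`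
  have hκ : F.sweep κ q (x + F.gen j) κ = F.sweep κ q x κ +
      (if F.cval κ x + 1 = F.period κ then F.rowCirc κ q x j else 0) := by
    rw [← F.sweep_self_add_gen_sub κ hcorr x hj, add_sub_cancel]
  rw [d₁_apply, hκ, F.sweep_of_ne κ q (x + F.gen κ) hj, F.sweep_of_ne κ q x hj]
  by_cases hx : F.cval κ x + 1 = F.period κ
  · -- wrapping edge: the partial sum restarts, the corrector supplies the circle sum
    rw [if_pos hx, F.add_gen_eq_dropCoord hx, F.axSum_of_cval_eq_zero _ (F.cval_dropCoord_self κ x),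
      F.rowCirc_of_ne κ q x hj]
    have hseam := F.axSum_seam κ (fun y => q y κ j) hx
    -- hseam : axSum x + q x κ j = circSum x
    rw [← hseam]
    abel
  · -- interior edge: one more term in the partial sum
    have hlt : F.cval κ x + 1 < F.period κ := lt_of_le_of_ne (F.cval_lt κ x) hx
    rw [if_neg hx, F.axSum_add_gen_self_of_lt κ _ hlt]
    abel

variable {F} in
/-- **The sweep does not disturb the directions already swept**: if `q` is alternating, closed and vanishes on
all pairs involving a direction `i < κ`, then `d₁ (sweep κ q) (x; i, j) = 0` for every such `i` and all `j`.
[folklore] -/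
theorem d₁_sweep_below (κ : Fin d) {q : Λ → Fin d → Fin d → A} (halt : IsAlt₂ q) (hq : F.d₂ q = 0)
    (hflux : ∀ j, F.flux q κ j = 0) (hvan : ∀ (x : Λ) (i j : Fin d), (i : ℕ) < κ → q x i j = 0)
    (x : Λ) {i : Fin d} (hi : (i : ℕ) < κ) (j : Fin d) :
    F.d₁ (F.sweep κ q) x i j = 0 := by
  have hiκ : i ≠ κ := fun h => by rw [h] at hi; exact lt_irrefl _ hi
  have hcorr := rowCirc_eq_d₀_prim κ hq hflux
  -- the row `q(·; κ, i)` vanishes, so the `i`-component of the sweep vanishes identically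
  have hrow0 : ∀ y, q y κ i = 0 := fun y => by rw [halt.swap, hvan y i κ hi, neg_zero]
  have hθi : ∀ y, F.sweep κ q y i = 0 := fun y => by
    rw [F.sweep_of_ne κ q y hiκ]
    exact F.axSum_eq_zero_of_forall κ hrow0 y
  rw [d₁_apply, hθi, hθi, zero_add, sub_zero]
  by_cases hj : j = κ
  · rw [hj, F.sweep_self_add_gen_sub κ hcorr x hiκ]
    split_ifs with hx
    · rw [F.rowCirc_of_ne κ q x hiκ, F.circSum_eq_zero_of_forall κ hrow0, neg_zero]
    · rfl
  · rw [F.sweep_of_ne κ q (x + F.gen i) hj, F.sweep_of_ne κ q x hj, F.axSum_add_gen_of_ne hiκ, ← axSum_sub]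
    refine F.axSum_eq_zero_of_forall κ (fun y => ?_) x
    -- closedness on the cell `(y; i, κ, j)` with the vanishing pairs `(i, j)`, `(i, κ)`
    have hv1 : ∀ z, q z i j = 0 := fun z => hvan z i j hi
    have hv2 : ∀ z, q z i κ = 0 := fun z => hvan z i κ hi
    have h := congr_fun (congr_fun (congr_fun (congr_fun hq y) i) κ) j
    simp only [d₂_apply, Pi.zero_apply, hv1, hv2, sub_zero, add_zero, sub_self] at h
    exact h

/-! ## The induction and the theorem -/

variable {F} in
/-- **Sweeping out the directions one at a time.** An alternating closed zero-flux `2`-cochain vanishing on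
all pairs involving a direction `< d - n` is a curl (induction on `n`). [folklore] -/
theorem exists_d₁_eq_of_vanish :
    ∀ (n : ℕ), n ≤ d → ∀ q : Λ → Fin d → Fin d → A, IsAlt₂ q → F.d₂ q = 0 → (∀ i j, F.flux q i j = 0) →
      (∀ (x : Λ) (i j : Fin d), (i : ℕ) < d - n → q x i j = 0) → ∃ θ : Λ → Fin d → A, F.d₁ θ = q
  | 0, _, q, _, _, _, hvan => ⟨0, by
      rw [d₁_zero]
      funext x i j
      exact (hvan x i j (by rw [Nat.sub_zero]; exact i.isLt)).symm⟩
  | n + 1, hn, q, halt, hq, hflux, hvan => by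
    have hk : d - (n + 1) < d := by omega
    obtain ⟨κ, hκ⟩ : ∃ κ : Fin d, (κ : ℕ) = d - (n + 1) := ⟨⟨d - (n + 1), hk⟩, rfl⟩
    have hvanκ : ∀ (x : Λ) (i j : Fin d), (i : ℕ) < κ → q x i j = 0 := fun x i j hi =>
      hvan x i j (by rw [← hκ]; exact hi)
    -- the remainder after the sweep in direction `κ`
    obtain ⟨q', hq'_def⟩ : ∃ q' : Λ → Fin d → Fin d → A, q' = q - F.d₁ (F.sweep κ q) := ⟨_, rfl⟩
    have halt' : IsAlt₂ q' := by rw [hq'_def]; exact halt.sub (F.isAlt₂_d₁ _)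
    have hq' : F.d₂ q' = 0 := by rw [hq'_def, d₂_sub, hq, d₂_d₁, sub_zero]
    have hflux' : ∀ i j, F.flux q' i j = 0 := fun i j => by
      rw [hq'_def, flux_sub, hflux, flux_d₁, sub_zero]
    have hvan' : ∀ (x : Λ) (i j : Fin d), (i : ℕ) < d - n → q' x i j = 0 := by
      intro x i j hi
      rw [hq'_def, Pi.sub_apply, Pi.sub_apply, Pi.sub_apply]
      rcases Nat.lt_or_ge (i : ℕ) (d - (n + 1)) with hlt | hge
      · -- a direction already swept
        have hltκ : (i : ℕ) < κ := by rw [hκ]; exact hlt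
        rw [hvan x i j hlt, d₁_sweep_below κ halt hq (fun j => hflux κ j) hvanκ x hltκ j, sub_zero]
      · -- the direction `κ` itself
        have hieq : i = κ := Fin.ext (by omega)
        subst hieq
        by_cases hj : j = i
        · rw [hj, halt.diag, d₁_self, sub_zero]
        · rw [d₁_sweep_row i hq (fun j => hflux i j) x hj, sub_self]
    obtain ⟨θ₂, hθ₂⟩ := exists_d₁_eq_of_vanish n (Nat.le_of_succ_le hn) q' halt' hq' hflux' hvan'
    refine ⟨F.sweep κ q + θ₂, ?_⟩
    rw [d₁_add, hθ₂, hq'_def, add_sub_cancel]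

/-- **The degree-two Poincaré lemma on a charted torus.** A `2`-cochain is a curl iff it is alternating,
closed, and has vanishing fluxes through the coordinate `2`-tori. [folklore] -/
theorem exists_d₁_eq_iff (q : Λ → Fin d → Fin d → A) :
    (∃ θ : Λ → Fin d → A, F.d₁ θ = q) ↔ IsAlt₂ q ∧ F.d₂ q = 0 ∧ ∀ i j, F.flux q i j = 0 := by
  constructor
  · rintro ⟨θ, rfl⟩
    exact ⟨F.isAlt₂_d₁ θ, F.d₂_d₁ θ, F.flux_d₁ θ⟩
  · rintro ⟨halt, hq, hflux⟩
    exact exists_d₁_eq_of_vanish d le_rfl q halt hq hflux fun x i j hi => absurd hi (by omega)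

/-- **The curls as a subgroup, explicitly**: `q ∈ curlImage ↔ q` alternating, closed, zero-flux. [folklore] -/
theorem mem_curlImage_iff_closed (q : Λ → Fin d → Fin d → A) :
    q ∈ F.curlImage (A := A) ↔ IsAlt₂ q ∧ F.d₂ q = 0 ∧ ∀ i j, F.flux q i j = 0 := by
  rw [mem_curlImage_iff, exists_d₁_eq_iff]

end TorusChart

end Literature.MathematicalPhysics.QuantumFieldTheory
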